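import Summits.NavierStokesRegularity.FluidComputer.AngularGalerkinLadder
import Literature.Analysis.FluidPDE.AncientMildCompactnessForced
import Literature.Analysis.FluidPDE.RotatedDSSWindowExtraction
import Literature.Analysis.FluidPDE.RotatedDSSLimitStructure
import Literature.Analysis.FluidPDE.LocalTypeIBlowup.SingularVertexZoom
import Literature.Analysis.FluidPDE.TypeIForcedOseenMild

/-!
# KJ-32a / KJ-33a — the ladder limit of an admissible window sequence, with the convergence EXPOSED

Refuter bookkeeping (ns-blowup refuter lineage, plain Negative lane, `--supports` item
stmt-NavierStokesRegularity-19960 `NoOverheating`; no definition, no route statement, NO route-file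
import — vocabulary `FluidComputer.AngularGalerkinLadder` and Literature only).

K3 `LimitTransfer` of route `AngularGalerkinLadder` was closed (p493315) by lean g11's extraction
`angularGalerkinLadder_limitTransfer_of_remainder` run on the Koch–Nadirashvili–Seregin–Šverák forced
Oseen-mild remainder bound `Literature.Analysis.FluidPDE.forcedOseenMild_remainder_typeI` (p492811).
The typed K3 hides the limit behind `∃ v` (no tie to the sequence). For NEGATIVE use — transporting
printed Liouville theorems for sub-classes (axisymmetric: KNSS 2009 Thm 5.3/§6; λ-DSS fine range:
Chae–Wolf 2017) onto the route's WINDOW SEQUENCES — the limit must be exposed together with its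
convergence. `exists_ladderLimit` is exactly g11's proof with the analytic brick discharged, returning:
a subsequence `φ`, the limit rotation `R'` with `R (φ n) → R'` pointwise, POINTWISE convergence on
`t < 0`, SLICE-LOCALLY-UNIFORM convergence on every `t < 0`, joint continuity of the limit `v` on
`(−∞,0) × ℝ³`, and the profile conjunction (`1 < c'`, ancient mild, measurable slices, rotated-DSS
`(c', R')`, Type-I with the SAME constant `C₀`, not a.e. zero).

v2 (KJ-33a, same seat): the extraction is re-run ONCE as `exists_ladderLimit_typeI`, exposing in
addition the window of the limit factor `c' ∈ [cmin, cmax]` with `c (φ n) → c'`, the strong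
KNSS-gauge class `IsTypeIAncientMild C₀ v` (jointly smooth, divergence free, Oseen-mild identity,
rate `C₀/√(−t)` — the class on which the tree's classical-representative and Chae–Wolf /
Pineau–Vicol theorems act) and the amplitude floor `δ ≤ ‖v(−1, x)‖`; `exists_ladderLimit` keeps
its statement and is now a projection.

Consumer: `AxisymmetricWindowsExcluded.lean` (KJ-32b: the `m = 0` stratum is excluded from the
window sequences). LABEL: KERNEL. WHAT THIS IS NOT: not NS — no rung solution, window or profile is
constructed; nothing here bears on whether window sequences exist.
References: [cite: KochNadirashviliSereginSverak2009, Lemma 3.1, Lemma 6.1, Prop. 4.1 (arXiv:0709.3599)];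
[cite: ChaeWolf2017, Def. 1.1].
-/

namespace Summit.NavierStokesRegularity.AngularGalerkinLadderLadderLimit

open Set Filter MeasureTheory Topology Function
open Literature.Analysis Literature.Analysis.FluidPDE
open Summit.NavierStokesRegularity.FluidComputer

/-! ### §0 Private helpers (copies of g11's two private lemmas) -/

/-- The Oseen–Duhamel term `B¹_s(a,b)(t)` only sees the fields on `(s, t)`. [folklore] -/
private theorem oseenDuhamel_congr'' {ν s t : ℝ}
    {a a' b b' : ℝ → EuclideanSpace ℝ (Fin 3) → EuclideanSpace ℝ (Fin 3)}
    (ha : ∀ τ ∈ Ioo s t, a τ = a' τ) (hb : ∀ τ ∈ Ioo s t, b τ = b' τ)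
    (x : EuclideanSpace ℝ (Fin 3)) :
    oseenDuhamel ν s a b t x = oseenDuhamel ν s a' b' t x := by
  rw [oseenDuhamel_apply, oseenDuhamel_apply]
  refine setIntegral_congr_fun measurableSet_Ioo fun τ hτ => ?_
  simp only [ha τ hτ, hb τ hτ]

/-- The Type-I time profile `τ ↦ C₀/√(−τ)` is monotone on `(−∞, 0)` for `C₀ ≥ 0`. [folklore] -/
private theorem monotoneOn_typeI_profile'' {C₀ : ℝ} (hC : 0 ≤ C₀) :
    MonotoneOn (fun τ : ℝ => C₀ / Real.sqrt (-τ)) (Iio 0) := by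
  intro a _ b hb hab
  have hb0 : 0 < Real.sqrt (-b) := Real.sqrt_pos.2 (by simpa using hb)
  exact div_le_div_of_nonneg_left hC hb0 (Real.sqrt_le_sqrt (by linarith))

/-! ### §1 The ladder limit, exposed -/

/-- **The ladder limit of an admissible window sequence, with the convergence exposed.** Every
admissible window sequence of the angular Galerkin ladder (`1 < cmin`, `0 < δ`, `ε_n → 0`, a window
rung profile at every index) has a subsequence `φ` along which the profiles converge — pointwise on
`t < 0` and locally uniformly on every slice `t < 0` — to a field `v`, jointly continuous on
`(−∞,0) × ℝ³`, which is a NONTRIVIAL Type-I (`C₀`) rotated-DSS (factor `c' > 1`) ancient mild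
solution of Navier–Stokes (`ν = 1`, no force). This is lean g11's proof of K3 (p481922/p482639) with
its analytic hypothesis discharged by `forcedOseenMild_remainder_typeI` (p492811), returning the limit
data instead of hiding it behind `∃ v`. **Strong form (v2)**: the limit factor lies in the window,
`c' ∈ [cmin, cmax]` with `c (φ n) → c'`, the limit is in the KNSS-gauge class
`IsTypeIAncientMild C₀ v`, and keeps the amplitude floor `δ ≤ ‖v(−1, x)‖` at some `x`.
[cite: KochNadirashviliSereginSverak2009, Lemma 6.1 and Prop. 4.1 (arXiv:0709.3599)] -/
theorem exists_ladderLimit_typeI {C₀ cmin cmax δ : ℝ} {L : ℕ → ℕ} {ε c : ℕ → ℝ}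
    {R : ℕ → (EuclideanSpace ℝ (Fin 3) ≃ₗᵢ[ℝ] EuclideanSpace ℝ (Fin 3))}
    {u : ℕ → ℝ → EuclideanSpace ℝ (Fin 3) → EuclideanSpace ℝ (Fin 3)}
    {p : ℕ → ℝ → EuclideanSpace ℝ (Fin 3) → ℝ}
    {d : ℕ → ℝ → EuclideanSpace ℝ (Fin 3) → EuclideanSpace ℝ (Fin 3)}
    (hcmin : 1 < cmin) (hδ : 0 < δ) (hε : Tendsto ε atTop (𝓝 0))
    (hW : ∀ n, AngularLadder.IsWindowProfile (L n) C₀ cmin cmax δ (ε n) (c n) (R n) (u n) (p n)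
      (d n)) :
    ∃ (φ : ℕ → ℕ) (c' : ℝ) (R' : EuclideanSpace ℝ (Fin 3) ≃ₗᵢ[ℝ] EuclideanSpace ℝ (Fin 3))
      (v : ℝ → EuclideanSpace ℝ (Fin 3) → EuclideanSpace ℝ (Fin 3)),
      StrictMono φ ∧ c' ∈ Icc cmin cmax ∧ Tendsto (fun n => c (φ n)) atTop (𝓝 c') ∧
      (∀ x, Tendsto (fun n => R (φ n) x) atTop (𝓝 (R' x))) ∧
      (∀ t < 0, ∀ x, Tendsto (fun n => u (φ n) t x) atTop (𝓝 (v t x))) ∧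
      (∀ t < 0, TendstoLocallyUniformly (fun n => u (φ n) t) (v t) atTop) ∧
      ContinuousOn (uncurry v) (Iio 0 ×ˢ univ) ∧ 1 < c' ∧ IsTypeIAncientMild C₀ v ∧
      (∀ t < 0, AEStronglyMeasurable (v t) volume) ∧ IsRotatedDSS c' R' v ∧ HasTypeIDecay C₀ v ∧
      (∃ x, δ ≤ ‖v (-1) x‖) ∧ ¬ (∀ t < 0, v t =ᵐ[volume] 0) := by
  -- window data
  have hcmem : ∀ n, c n ∈ Icc cmin cmax := fun n => ⟨(hW n).2.1, (hW n).2.2.1⟩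
  have hprof : ∀ n, AngularLadder.IsRungProfile (L n) C₀ (c n) (R n) (u n) (p n) (d n) :=
    fun n => (hW n).1
  have hcl : ∀ n, IsClassicalNSSolutionOn (Iio 0) 1 (d n) (u n) (p n) := fun n => (hprof n).classical
  have hTI : ∀ n, HasTypeIDecay C₀ (u n) := fun n => (hprof n).hasTypeIDecay
  have hdss : ∀ n, IsRotatedDSS (c n) (R n) (u n) := fun n => (hprof n).isRotatedDSS
  have hdef : ∀ n, AngularLadder.HasDefectBound (ε n) (d n) := fun n => (hW n).2.2.2.2
  have hamp : ∀ n, ∃ x, δ ≤ ‖u n (-1) x‖ := fun n => (hW n).2.2.2.1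
  have hucont : ∀ n, ContinuousOn (uncurry (u n)) (Iio 0 ×ˢ univ) := fun n =>
    (hcl n).smooth_velocity.continuousOn
  -- the constants are nonnegative (the spaces are inhabited)
  have hC₀ : 0 ≤ C₀ := by
    have h1 := (norm_nonneg _).trans (hTI 0 (-1) (by norm_num) 0)
    simpa using h1
  have hε0 : ∀ n, 0 ≤ ε n := fun n => by
    have h1 := (norm_nonneg _).trans (hdef n (-1) (by norm_num) 0)
    have h2 : (0 : ℝ) < (‖(0 : EuclideanSpace ℝ (Fin 3))‖ + Real.sqrt (-(-1 : ℝ))) ^ 3 := by simp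
    exact (div_nonneg_iff.1 h1).elim (fun h => h.1) fun h => absurd h.2 (not_le.2 h2)
  obtain ⟨M, hM⟩ : ∃ M : ℝ, ∀ n, ε n ≤ M := by
    obtain ⟨b, hb⟩ := hε.bddAbove_range
    exact ⟨b, fun n => hb ⟨n, rfl⟩⟩
  have hM0 : 0 ≤ M := (hε0 0).trans (hM 0)
  -- the analytic brick (KNSS Lemma 3.1 / §4 (i), p492811): absolute `Φ`, `K`
  obtain ⟨Φ, K, hΦmono, hΦ0, hrem⟩ := forcedOseenMild_remainder_typeI
  -- Step 1: the window parameters converge along `φ₁`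
  obtain ⟨φ₁, c', R', hφ₁, hc'mem, hc1, hR1⟩ := exists_subseq_window_tendsto hcmem R
  -- Step 2: the forced KNSS engine along `φ₁`
  have key := exists_oseenMild_limit_of_forced (E := EuclideanSpace ℝ (Fin 3))
    (A := fun k : ℕ => -((k : ℝ) + 1)) (w := fun k => u (φ₁ k))
    (G := fun k s t x => u (φ₁ k) t x - UnboundedOperators.heatExtension (u (φ₁ k) s) (t - s) x +
      oseenDuhamel 1 s (u (φ₁ k)) (u (φ₁ k)) t x)
    (β := fun τ => C₀ / Real.sqrt (-τ)) (γ := fun τ => M * Φ τ)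
    (by
      refine tendsto_atTop_atBot.2 fun b => ⟨Nat.ceil (-b), fun k hk => ?_⟩
      have h1 : -b ≤ (Nat.ceil (-b) : ℝ) := Nat.le_ceil _
      have h2 : (Nat.ceil (-b) : ℝ) ≤ k := by exact_mod_cast hk
      show -((k : ℝ) + 1) ≤ b
      linarith)
    (monotoneOn_typeI_profile'' hC₀)
    (fun a ha b hb hab => mul_le_mul_of_nonneg_left (hΦmono ha hb hab) hM0)
    (fun τ hτ => mul_nonneg hM0 (hΦ0 τ hτ))
    (fun k => (hucont (φ₁ k)).mono (prod_mono (fun t ht => ht.2) Subset.rfl))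
    (fun k t ht => VectorCalculus.IsDivFree.isWeaklyDivFree_holds ((hcl (φ₁ k)).divFree t ht.2)
      (contDiff_infty.1 ((hcl (φ₁ k)).contDiff_velocity ht.2) 1))
    (fun k s t _ _ _ x => by abel)
    (fun k s t _ hst ht hlag x => by
      have h1 := ((hrem (hcl (φ₁ k)) (hTI (φ₁ k)) (hdef (φ₁ k)) s t hst ht x).2 hlag)
      calc _ ≤ ε (φ₁ k) * Φ t * Real.sqrt (t - s) := h1
        _ ≤ M * Φ t * Real.sqrt (t - s) :=
            mul_le_mul_of_nonneg_right (mul_le_mul_of_nonneg_right (hM (φ₁ k)) (hΦ0 t ht))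
              (Real.sqrt_nonneg _))
    (fun s t hst ht x => by
      have hb : ∀ k, ‖u (φ₁ k) t x - UnboundedOperators.heatExtension (u (φ₁ k) s) (t - s) x +
          oseenDuhamel 1 s (u (φ₁ k)) (u (φ₁ k)) t x‖ ≤ ε (φ₁ k) * K s t := fun k =>
        (hrem (hcl (φ₁ k)) (hTI (φ₁ k)) (hdef (φ₁ k)) s t hst ht x).1
      have h0 : Tendsto (fun k => ε (φ₁ k) * K s t) atTop (𝓝 0) := by
        simpa using (hε.comp hφ₁.tendsto_atTop).mul_const (K s t)
      exact squeeze_zero_norm hb h0)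
    (fun k τ hτ x => by
      have h1 := hTI (φ₁ k) τ hτ.2 x
      have hpos : 0 < Real.sqrt (-τ) := Real.sqrt_pos.2 (by linarith [hτ.2])
      exact h1.trans (div_le_div_of_nonneg_left hC₀ hpos (by linarith [norm_nonneg x])))
  obtain ⟨φ₂, W, hφ₂, hWcont, hWdiv, -, hWmild, -, hptw, hloc⟩ := key
  -- Step 3: the cutoff field `v = W` on `t < 0`, `0` on `t ≥ 0`
  set v : ℝ → EuclideanSpace ℝ (Fin 3) → EuclideanSpace ℝ (Fin 3) :=
    fun t => if t < 0 then W t else 0 with hvdef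
  have hveq : ∀ t < 0, v t = W t := fun t ht => by simp only [hvdef, if_pos ht]
  have hv0 : ∀ t, 0 ≤ t → v t = 0 := fun t ht => by simp only [hvdef, if_neg (not_lt.2 ht)]
  have hvcont : ContinuousOn (uncurry v) (Iio 0 ×ˢ univ) :=
    hWcont.congr fun z hz => by
      change v z.1 z.2 = W z.1 z.2
      rw [hveq z.1 (mem_prod.1 hz).1]
  have hvdiv : ∀ t < 0, IsWeaklyDivFree (v t) := fun t ht => by
    rw [hveq t ht]
    exact hWdiv t ht
  have hvmild : ∀ s t : ℝ, s < t → t < 0 → ∀ x,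
      v t x = UnboundedOperators.heatExtension (v s) (t - s) x - oseenDuhamel 1 s v v t x := by
    intro s t hst ht x
    rw [hveq t ht, hveq s (hst.trans ht),
      oseenDuhamel_congr'' (fun τ hτ => hveq τ (hτ.2.trans ht)) (fun τ hτ => hveq τ (hτ.2.trans ht))]
    exact hWmild s t hst ht x
  -- Step 4: pointwise and slice convergence to `v`; the Type-I weight passes to the limit
  have hptw' : ∀ t < 0, ∀ x, Tendsto (fun n => u (φ₁ (φ₂ n)) t x) atTop (𝓝 (v t x)) :=
    fun t ht x => by
      rw [hveq t ht]
      exact hptw t ht x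
  have hloc' : ∀ t < 0, TendstoLocallyUniformly (fun n => u (φ₁ (φ₂ n)) t) (v t) atTop :=
    fun t ht => by
      rw [hveq t ht]
      exact hloc t ht
  have hvTI : HasTypeIDecay C₀ v := fun t ht x =>
    le_of_tendsto (hptw' t ht x).norm (Eventually.of_forall fun j => hTI (φ₁ (φ₂ j)) t ht x)
  -- Step 5: `v` is a Type-I ancient mild field (KNSS smoothing inside the tree theorem)
  have hTAM : IsTypeIAncientMild C₀ v :=
    LocalTypeIBlowup.isTypeIAncientMild_of_continuous_oseenMild_rate hvcont hvdiv hvmild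
      (hvTI.hasTypeITimeDecay hC₀)
  -- Step 6: rotated-DSS structure, measurability, non-triviality (lit g13's Baire/Osgood theorem)
  obtain ⟨hc', hDSS, -, hmeas, hampv, hnz⟩ :=
    typeI_rotatedDSS_structure_of_tendsto (μ := (volume : Measure (EuclideanSpace ℝ (Fin 3))))
      hcmin hδ (fun n => (hcmem (φ₁ (φ₂ n))).1) (hc1.comp hφ₂.tendsto_atTop)
      (fun x => (hR1 x).comp hφ₂.tendsto_atTop) (fun n => hdss (φ₁ (φ₂ n)))
      (fun n => hTI (φ₁ (φ₂ n))) (fun n => hucont (φ₁ (φ₂ n))) (fun n => hamp (φ₁ (φ₂ n)))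
      hvcont hv0 hptw' (hloc' (-1) (by norm_num))
  exact ⟨φ₁ ∘ φ₂, c', R', v, hφ₁.comp hφ₂, hc'mem, hc1.comp hφ₂.tendsto_atTop,
    fun x => (hR1 x).comp hφ₂.tendsto_atTop, hptw', hloc', hvcont, hc', hTAM, hmeas, hDSS, hvTI,
    hampv, hnz⟩

/-- **The ladder limit of an admissible window sequence, with the convergence exposed** (the
original KJ-32a statement, now a projection of `exists_ladderLimit_typeI`): a subsequence `φ`
along which the profiles converge — pointwise on `t < 0` and locally uniformly on every slice
`t < 0` — to a field `v`, jointly continuous on `(−∞,0) × ℝ³`, which is a NONTRIVIAL Type-I (`C₀`)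
rotated-DSS (factor `c' > 1`) ancient mild solution of Navier–Stokes (`ν = 1`, no force).
[cite: KochNadirashviliSereginSverak2009, Lemma 6.1 and Prop. 4.1 (arXiv:0709.3599)] -/
theorem exists_ladderLimit {C₀ cmin cmax δ : ℝ} {L : ℕ → ℕ} {ε c : ℕ → ℝ}
    {R : ℕ → (EuclideanSpace ℝ (Fin 3) ≃ₗᵢ[ℝ] EuclideanSpace ℝ (Fin 3))}
    {u : ℕ → ℝ → EuclideanSpace ℝ (Fin 3) → EuclideanSpace ℝ (Fin 3)}
    {p : ℕ → ℝ → EuclideanSpace ℝ (Fin 3) → ℝ}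
    {d : ℕ → ℝ → EuclideanSpace ℝ (Fin 3) → EuclideanSpace ℝ (Fin 3)}
    (hcmin : 1 < cmin) (hδ : 0 < δ) (hε : Tendsto ε atTop (𝓝 0))
    (hW : ∀ n, AngularLadder.IsWindowProfile (L n) C₀ cmin cmax δ (ε n) (c n) (R n) (u n) (p n)
      (d n)) :
    ∃ (φ : ℕ → ℕ) (c' : ℝ) (R' : EuclideanSpace ℝ (Fin 3) ≃ₗᵢ[ℝ] EuclideanSpace ℝ (Fin 3))
      (v : ℝ → EuclideanSpace ℝ (Fin 3) → EuclideanSpace ℝ (Fin 3)),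
      StrictMono φ ∧ (∀ x, Tendsto (fun n => R (φ n) x) atTop (𝓝 (R' x))) ∧
      (∀ t < 0, ∀ x, Tendsto (fun n => u (φ n) t x) atTop (𝓝 (v t x))) ∧
      (∀ t < 0, TendstoLocallyUniformly (fun n => u (φ n) t) (v t) atTop) ∧
      ContinuousOn (uncurry v) (Iio 0 ×ˢ univ) ∧ 1 < c' ∧ IsAncientMildSolution 1 v ∧
      (∀ t < 0, AEStronglyMeasurable (v t) volume) ∧ IsRotatedDSS c' R' v ∧ HasTypeIDecay C₀ v ∧
      ¬ (∀ t < 0, v t =ᵐ[volume] 0) := by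
  obtain ⟨φ, c', R', v, hφ, -, -, hR, hptw, hloc, hvcont, hc', hTAM, hmeas, hDSS, hvTI, -, hnz⟩ :=
    exists_ladderLimit_typeI hcmin hδ hε hW
  exact ⟨φ, c', R', v, hφ, hR, hptw, hloc, hvcont, hc', hTAM.isAncientMildSolution, hmeas, hDSS,
    hvTI, hnz⟩

end Summit.NavierStokesRegularity.AngularGalerkinLadderLadderLimit
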